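import Mathlib
import Literature.Analysis.FluidPDE.ClassicalSolution
import Literature.Analysis.FluidPDE.VectorCalculus
import Summits.NavierStokesRegularity.NavierStokesRegularity.Theses.ThreadingFlux
import Summits.NavierStokesRegularity.NavierStokesRegularity.Theorems.ThreadingFluxHorizonTowerDefs
import Summits.NavierStokesRegularity.NavierStokesRegularity.Theorems.ThreadingFluxHorizonTowerZonalAssembly
import Summits.NavierStokesRegularity.NavierStokesRegularity.Theorems.ThreadingFluxHorizonTowerTwoShellBracketByName
import Summits.NavierStokesRegularity.NavierStokesRegularity.Theorems.ThreadingFluxHorizonTowerTwoShellHorizonByName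
import Summits.NavierStokesRegularity.NavierStokesRegularity.Theorems.ThreadingFluxHorizonOrderOneLawBlowdown
import Summits.NavierStokesRegularity.NavierStokesRegularity.Theorems.ThreadingFluxHorizonTowerOrderTwoLaw
import Summits.NavierStokesRegularity.NavierStokesRegularity.Theorems.ThreadingFluxHorizonOrderTwoLawBlowdown

/-! # Sketch — crux idea «horizon-threading-tower» for `PoloidalLiouville` (stmt-NavierStokesRegularity-1222)

Lens «negation», bounded NON-DECAYING endpoint.  Typed first lemmas (Props only; nothing is proved here; NS regularity is
NOT proved by any of this).  Notation: centre `x₀`, `y = x − x₀`, `r = ‖y‖`, `ξ = y/r`, threading flux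
`F(t,x) = ⟪curl u(t) x, y⟫`, threading jets `c_k = ∂ₜᵏ F|_{t₀}`.

* HEAD–VIRIAL IDENTITY (engine E1, index proof in the card): for `ω ⊥ y`, `div ω = 0` and any scalar `B`,
  `⟪y, curl (∇B × ω)⟫ = ⟪ω, ∇(y·∇B)⟫`.  Hence `c₂ = Loc₂[u] − ⟪ω, ∇(r ∂ᵣ B)⟫`, `B = p + |u|²/2`: the ONLY non-local
  input to the order-two threading coefficient is the radial virial of the Bernoulli head, differentiated along vortex lines.
* HORIZON (scale-free far field `u → U(ξ)`, degree-0 homogeneous): `r∂ᵣB → const` on spheres, so the pressure DROPS OUT: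
  `r² c₂ → 𝔏₂[U]`, a local, purely inertial cubic law on `S²`; order one: `r c₁ → 𝔏₁[U] = −r⟪y, ∇f × ∇Φ⟫`,
  `f = U·ξ`, `Δ_S Φ = −2f`, i.e. `𝔏₁ ≡ 0` iff `Φ` is a STEADY 2D-EULER STREAM FUNCTION on the sphere at infinity.
* TABLE (engine, exact): `𝔏₂` of the degree-2 profile `= −256 det(y,Qy,Q²y)/r³` (zero iff uniaxial; = g0's `Z(1) = −64`,
  now seen to be pressure-free); tetrahedral cubic `xyz`: `80 (x²−y²)(x²−z²)(y²−z²)/r⁶ ≠ 0`; octahedral quartic: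
  `3456000·xyz(x²−y²)(x²−z²)(y²−z²)/r⁹ ≠ 0`; zonal profiles of degree 2,3,4,(5): `0`; Jacobian at the zonal cubic has
  corank 3 (local rigidity).  -/

set_option linter.dupNamespace false

namespace Summit.NavierStokesRegularity.NavierStokesRegularity.Cruxes.PoloidalLiouville.HorizonTower

open scoped Topology
open Filter Set MeasureTheory
open Literature.Analysis.FluidPDE (cross curl)

/-- ℝ³. -/
abbrev E3 : Type := EuclideanSpace ℝ (Fin 3)

/-- Threading flux `F(t,x) = ⟪curl u(t) x, x − x₀⟫`. -/
noncomputable def threadingFlux (u : ℝ → E3 → E3) (x₀ : E3) (t : ℝ) (x : E3) : ℝ :=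
  inner ℝ (curl (u t) x) (x - x₀)

/-- Radial virial `(y·∇)B` of a scalar about `x₀`. -/
noncomputable def radialVirial (B : E3 → ℝ) (x₀ : E3) (x : E3) : ℝ := inner ℝ (x - x₀) (gradient B x)

/-- Bernoulli head `B = p + |u|²/2` of a slice. -/
noncomputable def head (u : E3 → E3) (p : E3 → ℝ) (x : E3) : ℝ := p x + ‖u x‖ ^ 2 / 2

/-- LOCAL part of the order-two threading coefficient (viscosity 1): with `ω = curl u`, `λ = u × ω`,
`a = λ + Δu` (= `∂ₜu + ∇B`), `N = curl λ + Δω` (= `∂ₜω`):  `Loc₂[u](x) = ⟪y, curl(a × ω) + curl(u × N) + ΔN⟫`. -/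
noncomputable def loc2 (u : E3 → E3) (x₀ : E3) (x : E3) : ℝ :=
  inner ℝ (x - x₀)
    (curl (fun z => cross (cross (u z) (curl u z) + Laplacian.laplacian u z) (curl u z)) x
      + curl (fun z => cross (u z)
          (curl (fun w => cross (u w) (curl u w)) z + Laplacian.laplacian (curl u) z)) x
      + Laplacian.laplacian (fun z => curl (fun w => cross (u w) (curl u w)) z + Laplacian.laplacian (curl u) z) x)

/-- Degree-0 homogeneity about `x₀` (scale-free far-field profiles). -/
def IsZeroHomogeneousAbout (x₀ : E3) (U : E3 → E3) : Prop :=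
  ∀ c : ℝ, 0 < c → ∀ y : E3, U (x₀ + c • y) = U (x₀ + y)

/-- ORDER-ONE HORIZON LAW `𝔏₁[U](x) = r ⟪y, curl(U × curl U)⟫` (degree 0 when `U` is degree-0 homogeneous). -/
noncomputable def horizonL1 (U : E3 → E3) (x₀ : E3) (x : E3) : ℝ :=
  ‖x - x₀‖ * inner ℝ (x - x₀) (curl (fun z => cross (U z) (curl U z)) x)

/-- ORDER-TWO HORIZON LAW `𝔏₂[U](x) = r² ⟪y, curl((U×Ω)×Ω) + curl(U × curl(U×Ω))⟫`, `Ω = curl U`: the purely inertial,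
LOCAL leading far-field term of `c₂` for scale-free slices (the head term drops by the head–virial identity). -/
noncomputable def horizonL2 (U : E3 → E3) (x₀ : E3) (x : E3) : ℝ :=
  ‖x - x₀‖ ^ 2 * inner ℝ (x - x₀)
    (curl (fun z => cross (cross (U z) (curl U z)) (curl U z)) x
      + curl (fun z => cross (U z) (curl (fun w => cross (U w) (curl U w)) z)) x)

/-- The degree-`l` HORIZON PROFILE of a degree-`l` solid harmonic `H`: `U = curl curl (r^{1−l} H(y) y)` — the degree-0
homogeneous (bounded, non-decaying) member of the single-degree poloidal shell family (`h(r) = r^{1−l}`). -/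
noncomputable def horizonProfile (l : ℕ) (H : E3 → ℝ) (x₀ : E3) : E3 → E3 :=
  curl (curl (fun z : E3 => (‖z - x₀‖ ^ ((1 : ℤ) - l) * H (z - x₀)) • (z - x₀)))

/-- The single-degree poloidal shell slice with radial profile `h`: `u = curl curl (h(r) H(y) y)`. -/
noncomputable def shellSlice (h : ℝ → ℝ) (H : E3 → ℝ) (x₀ : E3) : E3 → E3 :=
  curl (curl (fun z : E3 => (h ‖z - x₀‖ * H (z - x₀)) • (z - x₀)))

/-- Bounded-endpoint tail `h = c r^{1−l} + O(r^{1−l−δ})` with eight derivatives (`Loc₂` differentiates the slice six times,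
the slice differentiates `h` twice): the slice is bounded and does NOT decay. -/
def HasEndpointTail (l : ℕ) (h : ℝ → ℝ) (c : ℝ) : Prop :=
  c ≠ 0 ∧ ∃ δ C : ℝ, 0 < δ ∧ ∀ k ≤ 8, ∀ t : ℝ, 1 ≤ t →
    |iteratedDeriv k (fun s => h s - c * s ^ ((1 : ℤ) - l)) t| ≤ C * t ^ (-((l : ℝ) - 1 + k + δ))

/-- Traceless symmetric shape tensor. -/
def IsShapeTensor (Q : E3 →L[ℝ] E3) : Prop :=
  (∀ a b : E3, inner ℝ (Q a) b = inner ℝ a (Q b)) ∧ LinearMap.trace ℝ E3 (Q : E3 →ₗ[ℝ] E3) = 0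

/-! ## First lemmas (provable now) -/

/-- HEAD–VIRIAL IDENTITY (S; pure vector calculus, engine E1): for `ω` tangent to the spheres about `x₀` and divergence
free, and any `C²` scalar `B`, `⟪y, curl(∇B × ω)⟫ = ⟪ω, ∇((y·∇)B)⟫`. -/
def HeadVirialIdentity : Prop :=
  ∀ (ω : E3 → E3) (B : E3 → ℝ) (x₀ : E3), ContDiff ℝ 1 ω → ContDiff ℝ 2 B →
    (∀ x, inner ℝ (ω x) (x - x₀) = 0) → Literature.Analysis.FluidPDE.VectorCalculus.IsDivFree ω →
    ∀ x, inner ℝ (x - x₀) (curl (fun z => cross (gradient B z) (ω z)) x)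
      = inner ℝ (ω x) (gradient (radialVirial B x₀) x)

/-- ORDER-ONE FLUX IDENTITY (S): for an unthreaded slice, `⟪y, curl(u × ω)⟫ = ⟪ω, ∇m⟫`, `m = ⟪u, y⟫` (so `c₁ = ω·∇m`:
the radial momentum is a first integral along vortex lines iff the slice is unthreaded to order one). -/
def OrderOneFluxIdentity : Prop :=
  ∀ (u : E3 → E3) (x₀ : E3), ContDiff ℝ 2 u → (∀ x, inner ℝ (curl u x) (x - x₀) = 0) →
    ∀ x, inner ℝ (x - x₀) (curl (fun z => cross (u z) (curl u z)) x)
      = inner ℝ (curl u x) (gradient (fun z => inner ℝ (u z) (z - x₀)) x)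

/-- SECOND-JET HEAD FORM (M): for a classical NS solution (ν = 1, no force) unthreaded at `t₀`,
`∂ₜ²F(t₀,x) = Loc₂[u(t₀)](x) − ⟪ω, ∇(r∂ᵣB)⟫`, `B = p(t₀) + |u(t₀)|²/2` — the pressure enters `c₂` only through the
radial virial of the head along vortex lines. -/
def SecondJetHeadForm : Prop :=
  ∀ (S : Set ℝ) (u : ℝ → E3 → E3) (p : ℝ → E3 → ℝ) (x₀ : E3) (t₀ : ℝ), IsOpen S → t₀ ∈ S →
    Literature.Analysis.FluidPDE.IsClassicalNSSolutionOn S 1 0 u p →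
    (∀ x, threadingFlux u x₀ t₀ x = 0) →
    ∀ x, iteratedDeriv 2 (fun t => threadingFlux u x₀ t x) t₀
      = loc2 (u t₀) x₀ x - inner ℝ (curl (u t₀) x) (gradient (radialVirial (head (u t₀) (p t₀)) x₀) x)

/-- HORIZON PROFILE STRUCTURE (S–M, engine E2/E3): for a degree-`l` solid harmonic `H` (`l ≥ 1`) the horizon profile
`U = curl curl(r^{1−l}H y)` is degree-0 homogeneous, divergence free and unthreaded on `ℝ³ ∖ {0}`; its radial part is
`f = l(l+1) H/r^l`, `U = f ξ + r ∇Φ` with `Φ = 2H/r^l` and `r²ΔΦ = −2f`; and `𝔏₁[U] ≡ 0`. -/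
def HorizonProfileStructure : Prop :=
  ∀ (l : ℕ) (H : E3 → ℝ), 1 ≤ l → ContDiff ℝ (⊤ : ℕ∞) H → (∀ (c : ℝ) (y : E3), H (c • y) = c ^ l * H y) →
    (∀ y, Laplacian.laplacian H y = 0) →
    IsZeroHomogeneousAbout 0 (horizonProfile l H 0) ∧
    (∀ x : E3, x ≠ 0 → Literature.Analysis.FluidPDE.VectorCalculus.divergence (horizonProfile l H 0) x = 0) ∧
    (∀ x : E3, x ≠ 0 → inner ℝ (curl (horizonProfile l H 0) x) x = 0) ∧
    (∀ x : E3, x ≠ 0 → horizonProfile l H 0 x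
        = ((l * (l + 1) : ℝ) * H x / ‖x‖ ^ l / ‖x‖) • x + ‖x‖ • gradient (fun z : E3 => 2 * H z / ‖z‖ ^ l) x) ∧
    (∀ x : E3, x ≠ 0 → ‖x‖ ^ 2 * Laplacian.laplacian (fun z : E3 => 2 * H z / ‖z‖ ^ l) x
        = -2 * ((l * (l + 1) : ℝ) * H x / ‖x‖ ^ l)) ∧
    (∀ x : E3, x ≠ 0 → horizonL1 (horizonProfile l H 0) 0 x = 0)

/-- ORDER-ONE HORIZON LAW = STEADY EULER ON THE SPHERE (M, engine E3b): for a smooth degree-0 homogeneous, divergence-free,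
unthreaded profile `U` with radial part `f = ⟪U, ξ⟫` and tangential potential `Φ` (`r²ΔΦ = −2f`),
`𝔏₁[U] = −r ⟪y, ∇f × ∇Φ⟫`; so `𝔏₁ ≡ 0` iff `{Δ_S Φ, Φ} = 0`, i.e. `Φ` is a stationary 2D-Euler stream function on `S²`. -/
def OrderOneSphereEuler : Prop :=
  ∀ (U : E3 → E3) (f Φ : E3 → ℝ) (x₀ : E3),
    ContDiffOn ℝ (⊤ : ℕ∞) U {x₀}ᶜ → ContDiffOn ℝ (⊤ : ℕ∞) Φ {x₀}ᶜ →
    IsZeroHomogeneousAbout x₀ U → (∀ c : ℝ, 0 < c → ∀ y : E3, Φ (x₀ + c • y) = Φ (x₀ + y)) →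
    (∀ x, x ≠ x₀ → Literature.Analysis.FluidPDE.VectorCalculus.divergence U x = 0) →
    (∀ x, x ≠ x₀ → inner ℝ (curl U x) (x - x₀) = 0) →
    (∀ x, x ≠ x₀ → f x = inner ℝ (U x) (x - x₀) / ‖x - x₀‖) →
    (∀ x, x ≠ x₀ → ‖x - x₀‖ ^ 2 * Laplacian.laplacian Φ x = -2 * f x) →
    ∀ x, x ≠ x₀ → horizonL1 U x₀ x = -‖x - x₀‖ * inner ℝ (x - x₀) (cross (gradient f x) (gradient Φ x))

/-- ORDER-TWO HORIZON LAW (M–L; the lever): a classical NS solution whose slice at `t₀` is unthreaded and has a scale-free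
far field — `u(t₀) = U + O(r^{−δ})` with six derivatives, `p(t₀) = P₀ + s₀ log r + O(r^{−δ})` with two derivatives,
`U`, `P₀` degree-0 homogeneous — satisfies `ρ² ∂ₜ²F(t₀, x₀ + ρξ) → 𝔏₂[U](ξ)` as `ρ → ∞`: at the horizon the order-two
threading coefficient is LOCAL and pressure-free. -/
def OrderTwoHorizonLaw : Prop :=
  ∀ (S : Set ℝ) (u : ℝ → E3 → E3) (p : ℝ → E3 → ℝ) (x₀ : E3) (t₀ : ℝ) (U : E3 → E3) (P₀ : E3 → ℝ) (s₀ δ C : ℝ),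
    IsOpen S → t₀ ∈ S → Literature.Analysis.FluidPDE.IsClassicalNSSolutionOn S 1 0 u p → 0 < δ →
    ContDiffOn ℝ (⊤ : ℕ∞) U {x₀}ᶜ → IsZeroHomogeneousAbout x₀ U →
    ContDiffOn ℝ (⊤ : ℕ∞) P₀ {x₀}ᶜ → (∀ c : ℝ, 0 < c → ∀ y : E3, P₀ (x₀ + c • y) = P₀ (x₀ + y)) →
    (∀ k ≤ 6, ∀ x : E3, 1 ≤ ‖x - x₀‖ →
        ‖iteratedFDeriv ℝ k (fun z => u t₀ z - U z) x‖ ≤ C * ‖x - x₀‖ ^ (-((k : ℝ) + δ))) →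
    (∀ k ≤ 2, ∀ x : E3, 1 ≤ ‖x - x₀‖ →
        ‖iteratedFDeriv ℝ k (fun z => p t₀ z - P₀ z - s₀ * Real.log ‖z - x₀‖) x‖ ≤ C * ‖x - x₀‖ ^ (-((k : ℝ) + δ))) →
    (∀ x, threadingFlux u x₀ t₀ x = 0) →
    ∀ ξ : E3, ‖ξ‖ = 1 →
      Tendsto (fun ρ : ℝ => ρ ^ 2 * iteratedDeriv 2 (fun t => threadingFlux u x₀ t (x₀ + ρ • ξ)) t₀) atTop
        (𝓝 (horizonL2 U x₀ (x₀ + ξ)))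

/-- BLOW-DOWN DATA of a slice `(w, q)` about `x₀`: along some `λₖ → ∞` the rescaled slice `y ↦ w (x₀ + λₖ y)` converges to `U`
with six derivatives, uniformly on compact subsets of `ℝ³ ∖ {0}`, and the rescaled pressure converges to `P` modulo constants `cₖ` with
two derivatives.  (No rate, no power remainder: slowly modulated far fields — e.g. `log log`-modulated ones — have such limit points;
only far fields modulated at unit rate in `log r` (discretely self-similar horizons) have none that are homogeneous.) -/
def IsBlowdownLimit (w : E3 → E3) (q : E3 → ℝ) (x₀ : E3) (U : E3 → E3) (P : E3 → ℝ) : Prop :=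
  ∃ (lam : ℕ → ℝ) (c : ℕ → ℝ), Tendsto lam atTop atTop ∧
    (∀ K : Set E3, IsCompact K → (0 : E3) ∉ K → ∀ j ≤ 6,
      Tendsto (fun k => sSup ((fun y => ‖iteratedFDeriv ℝ j (fun z : E3 => w (x₀ + lam k • z) - U z) y‖) '' K))
        atTop (𝓝 0)) ∧
    (∀ K : Set E3, IsCompact K → (0 : E3) ∉ K → ∀ j ≤ 2,
      Tendsto (fun k => sSup ((fun y => ‖iteratedFDeriv ℝ j (fun z : E3 => q (x₀ + lam k • z) - c k - P z) y‖) '' K))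
        atTop (𝓝 0))

/-- [SUPERSEDED as the sieve of record by `OrderTwoHorizonLawBlowdownReg` — director ruling (1), 2026-08-29T04:09:29Z; kept as record.]
ORDER-ONE/TWO HORIZON LAWS, BLOW-DOWN FORM (M–L; the general sieve): if a classical NS solution is unthreaded about `x₀` on an
open window and a slice has a blow-down limit `(U, P₀ + s₀ log r)` with `U`, `P₀` degree-0 homogeneous, then `𝔏₁[U] ≡ 0` and
`𝔏₂[U] ≡ 0`.  Proof sketch: `λₖ² c₂(x₀ + λₖ y) = ⟪y, V[uₖ]⟫(y) − ⟪curl uₖ, ∇(r∂ᵣBₖ)⟫(y) + O(λₖ⁻²)` by scaling each term of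
`SecondJetHeadForm`; the head term tends to `⟪Ω, ∇(r∂ᵣ(P₀ + s₀ log r + |U|²/2))⟫ = ⟪Ω, ∇ s₀⟫ = 0`. -/
def OrderTwoHorizonLawBlowdown : Prop :=
  ∀ (S : Set ℝ) (u : ℝ → E3 → E3) (p : ℝ → E3 → ℝ) (x₀ : E3) (t₀ : ℝ) (U : E3 → E3) (P₀ : E3 → ℝ) (s₀ : ℝ),
    IsOpen S → t₀ ∈ S → Literature.Analysis.FluidPDE.IsClassicalNSSolutionOn S 1 0 u p →
    (∀ t ∈ S, ∀ x, threadingFlux u x₀ t x = 0) →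
    IsZeroHomogeneousAbout 0 U → (∀ c : ℝ, 0 < c → ∀ y : E3, P₀ (c • y) = P₀ y) →
    IsBlowdownLimit (u t₀) (p t₀) x₀ U (fun y : E3 => P₀ y + s₀ * Real.log ‖y‖) →
    ∀ y : E3, y ≠ 0 → horizonL1 U 0 y = 0 ∧ horizonL2 U 0 y = 0

/-- [SUPERSEDED as the sieve of record by `HorizonSieveReg` (THEOREM, p694045) — director ruling (1); kept as record.]
HORIZON SIEVE (the W1-level typed constraint on counterexamples; M–L given the blow-down law and the bridge
`Theorems.PoloidalLiouville.exists_isClassicalNSSolutionOn_Ioo`): under the hypotheses of `PoloidalLiouville` itself, with `p` any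
classical pressure of `v` on `(−∞, 0)`, EVERY homogeneous blow-down limit of EVERY slice is annihilated by both horizon laws.
SCOPE (V9-P2, v2): the sieve binds ONLY counterexamples possessing a `C⁶` blow-down limit (`IsBlowdownLimit`), i.e. slices with a
SCALE-FREE far field in the quantitative sense `‖∇ʲ v(t₀, x)‖ ≲ ‖x − x₀‖^{−j}` for `j ≤ 6` (modulation rate in `log r` tending to 0);
a general bounded ancient solution has bounded — not `O(1/r^j)` — derivatives and need not have any such limit point: there the sieve
is SILENT (it is a constraint on the scale-free cell, not on the bounded class). -/
def HorizonSieve : Prop :=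
  ∀ (v : ℝ → E3 → E3) (p : ℝ → E3 → ℝ) (x₀ : E3),
    Literature.Analysis.FluidPDE.IsBoundedAncientMildSolution 1 v →
    Literature.Analysis.FluidPDE.IsClassicalNSSolutionOn (Set.Iio 0) 1 0 v p →
    (∀ t < 0, ∀ x, inner ℝ (x - x₀) (curl (v t) x) = 0) →
    ∀ t₀ < 0, ∀ (U : E3 → E3) (P₀ : E3 → ℝ) (s₀ : ℝ),
      IsZeroHomogeneousAbout 0 U → (∀ c : ℝ, 0 < c → ∀ y : E3, P₀ (c • y) = P₀ y) →
      IsBlowdownLimit (v t₀) (p t₀) x₀ U (fun y : E3 => P₀ y + s₀ * Real.log ‖y‖) →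
      ∀ y : E3, y ≠ 0 → horizonL1 U 0 y = 0 ∧ horizonL2 U 0 y = 0

/-! ## The table (exact algebraic identities, engine E4; each decidable by symbolic algebra) -/

/-- Degree 2: `𝔏₂[U_Q] = −256 det(y, Qy, Q²y)/r³` for `H = ⟪y,Qy⟫` — zero iff `Q` is uniaxial (axisymmetric shell).
(This is the bounded endpoint `σ = 1` of the g0 card: `Z(1) = −64`, here identified as purely local/inertial.) -/
def HorizonL2Quadrupole : Prop :=
  ∀ Q : E3 →L[ℝ] E3, IsShapeTensor Q →
    ∀ x : E3, x ≠ 0 → horizonL2 (horizonProfile 2 (fun y : E3 => inner ℝ y (Q y)) 0) 0 x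
      = -256 * inner ℝ x (cross (Q x) (Q (Q x))) / ‖x‖ ^ 3

/-- Degree 3, tetrahedral class `H = xyz` (which ESCAPES the far-field quadrupole law: `N(H) = 0`): the horizon law
threads it at order two, `𝔏₂ = 80 (x²−y²)(x²−z²)(y²−z²)/r⁶` (the product of the six diagonal mirror planes). -/
def HorizonL2Tetrahedral : Prop :=
  ∀ x : E3, x ≠ 0 → horizonL2 (horizonProfile 3 (fun y : E3 => y 0 * y 1 * y 2) 0) 0 x
    = 80 * ((x 0) ^ 2 - (x 1) ^ 2) * ((x 0) ^ 2 - (x 2) ^ 2) * ((x 1) ^ 2 - (x 2) ^ 2) / ‖x‖ ^ 6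

/-- Degree 4, octahedral class `H = 5(x⁴+y⁴+z⁴) − 3r⁴` (isotropic: `N(H) = 0`): threads at order two,
`𝔏₂ = 3456000 · xyz (x²−y²)(x²−z²)(y²−z²)/r⁹` (the product of the nine mirror planes of `O_h`). -/
def HorizonL2Octahedral : Prop :=
  ∀ x : E3, x ≠ 0 →
    horizonL2 (horizonProfile 4 (fun y : E3 => 5 * ((y 0) ^ 4 + (y 1) ^ 4 + (y 2) ^ 4) - 3 * ‖y‖ ^ 4) 0) 0 x
    = 3456000 * (x 0 * x 1 * x 2) * ((x 0) ^ 2 - (x 1) ^ 2) * ((x 0) ^ 2 - (x 2) ^ 2) * ((x 1) ^ 2 - (x 2) ^ 2)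
        / ‖x‖ ^ 9

/-- Zonal profiles are annihilated (S; axisymmetric-no-swirl far fields never thread: `Ω` is azimuthal, `U×Ω` and
`(U×Ω)×Ω` are meridional, their curls azimuthal, so `⟪y, ·⟫ = 0`; engine-verified for degrees 2, 3, 4). -/
def HorizonL2Zonal : Prop :=
  ∀ (l : ℕ) (a : E3) (g : ℝ → ℝ), 2 ≤ l → a ≠ 0 → ContDiff ℝ (⊤ : ℕ∞) g →
    (∀ y : E3, Laplacian.laplacian (fun z : E3 => ‖z‖ ^ l * g (inner ℝ a z / ‖z‖)) y = 0) →
    ∀ x : E3, x ≠ 0 → horizonL2 (horizonProfile l (fun z : E3 => ‖z‖ ^ l * g (inner ℝ a z / ‖z‖)) 0) 0 x = 0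

/-! ## The typed obstruction (negation lens) and the rung it feeds -/

/-- [THEOREM — KERNEL, BY NAME, ALL DEGREES l ≥ 2 (v-next 2026-08-29): `Theorems/ThreadingFluxHorizonTowerZonalAssembly.lean` p680436
`…Theorems.PoloidalLiouville.HorizonTower.horizonZonalitySingleDegree` (ns-wall-eng-5 g4, via `Zonal.detZonal_allDegrees` + 7 slice files; reduction
ns-wall-eng-4 p673002, zonal-form lemma ns-wall-eng-7 p667875; BY-NAME ✓ ns-wall-crit-1 00:07:32Z) — closed below as `horizonZonalitySingleDegree_holds`,
with an `Iff.rfl` guard against the Defs twin.  History: CONJECTURE for general `l` at filing (V9-P4), DECIDED CELLS then: l = 2 (`HorizonL2Quadrupole`, table);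
l = 3 GLOBAL — DATUM B-ht1 (ns-wall-eng-7 g2, preregistered, jobs j316258/j316338): WORD = ZONAL-ONLY (SO(3)-slice ideal radical, lex GB
`{2a₄+3a₆²−3a₇², a₆(a₆²−4), a₆a₇, a₇(a₇²−4)}`, five rational points, all zonal; all 28 zonality minors in the radical); l = 4, 5, 6
ZONAL-ONLY exploratory (same exact method). Open: l ≥ 7 and the tower form.] HORIZON ZONALITY, single-degree form (conjecture beyond the verified cells; l = 2 is `HorizonL2Quadrupole`, l = 3 holds
locally near the zonal cubic by the engine's Jacobian corank-3 computation): a degree-`l` solid harmonic whose horizon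
profile is annihilated by `𝔏₂` is zonal about some axis. -/
def HorizonZonalitySingleDegree : Prop :=
  ∀ (l : ℕ) (H : E3 → ℝ), 2 ≤ l → ContDiff ℝ (⊤ : ℕ∞) H → (∀ (c : ℝ) (y : E3), H (c • y) = c ^ l * H y) →
    (∀ y, Laplacian.laplacian H y = 0) →
    (∀ x : E3, x ≠ 0 → horizonL2 (horizonProfile l H 0) 0 x = 0) →
    ∃ (a : E3) (g : ℝ → ℝ), a ≠ 0 ∧ ∀ y : E3, y ≠ 0 → H y = ‖y‖ ^ l * g (inner ℝ a y / ‖y‖)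

/-- [CONJECTURE — booked as such, no rung credit (V9-P4)] HORIZON ZONALITY, tower form (the typed obstruction; conjecture): a smooth scale-free unthreaded divergence-free profile
annihilated by the order-one AND order-two horizon laws has zonal radial part — i.e. every bounded unthreaded ancient flow
with a scale-free far field is asymptotically axisymmetric without swirl (or asymptotically constant). -/
def HorizonTowerZonality : Prop :=
  ∀ (U : E3 → E3) (x₀ : E3), ContDiffOn ℝ (⊤ : ℕ∞) U {x₀}ᶜ → IsZeroHomogeneousAbout x₀ U →
    (∀ x, x ≠ x₀ → Literature.Analysis.FluidPDE.VectorCalculus.divergence U x = 0) →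
    (∀ x, x ≠ x₀ → inner ℝ (curl U x) (x - x₀) = 0) →
    (∀ x, x ≠ x₀ → horizonL1 U x₀ x = 0) → (∀ x, x ≠ x₀ → horizonL2 U x₀ x = 0) →
    ∃ (a : E3) (g : ℝ → ℝ), a ≠ 0 ∧
      ∀ x, x ≠ x₀ → inner ℝ (U x) (x - x₀) = ‖x - x₀‖ * g (inner ℝ a (x - x₀) / ‖x - x₀‖)

/-- [v1 — SUPERSEDED per V9-P1 by `BoundedEndpointShellRungDatum` / `BoundedEndpointTailRung` below: an EXACT single-degree
slice at an INTERIOR time of an unthreaded window is not known to occur (single-degree exactness is not propagated), so this form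
risks being true for lack of instances; kept for the record.] BOUNDED-ENDPOINT SHELL RUNG (M–L given `OrderTwoHorizonLaw`; the W2 window rung at the non-decaying endpoint, all
degrees, no pressure normalisation beyond sublinear growth): a classical NS solution on an open window, unthreaded about `x₀`
at all times of the window, whose slice at `t₀` is a single-degree shell with a bounded-endpoint tail, has a horizon profile
annihilated by `𝔏₂` (hence zonal by the table / `HorizonZonalitySingleDegree`; for `l = 2`: axisymmetric, closing the
`σ = 1` cell of the g0 rung pressure-free). -/
def BoundedEndpointShellRung : Prop :=
  ∀ (S : Set ℝ) (u : ℝ → E3 → E3) (p : ℝ → E3 → ℝ) (x₀ : E3) (t₀ : ℝ) (l : ℕ) (H : E3 → ℝ) (h : ℝ → ℝ) (c : ℝ),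
    IsOpen S → t₀ ∈ S → Literature.Analysis.FluidPDE.IsClassicalNSSolutionOn S 1 0 u p →
    2 ≤ l → ContDiff ℝ (⊤ : ℕ∞) H → (∀ (a : ℝ) (y : E3), H (a • y) = a ^ l * H y) →
    (∀ y, Laplacian.laplacian H y = 0) → (∃ y, H y ≠ 0) →
    ContDiff ℝ (⊤ : ℕ∞) (fun y : E3 => h ‖y‖) → HasEndpointTail l h c →
    Tendsto (fun x : E3 => p t₀ x / (1 + ‖x - x₀‖)) (Filter.cocompact E3) (𝓝 0) →
    u t₀ = shellSlice h H x₀ →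
    (∀ t ∈ S, ∀ x, threadingFlux u x₀ t x = 0) →
    ∀ x : E3, x ≠ 0 → horizonL2 (horizonProfile l H 0) 0 x = 0

/-- BOUNDED-ENDPOINT SHELL RUNG, DATUM FORM (v2, V9-P1; M–L given a one-sided `OrderTwoHorizonLaw` at the initial time): a
classical NS solution on `[t₀, t₁)` (smooth up to `t₀`), unthreaded about `x₀` for `t ∈ (t₀, t₁)`, whose DATUM `u t₀` is the
single-degree shell with a bounded-endpoint tail and whose initial pressure grows sublinearly, has a horizon profile annihilated by
`𝔏₂`.  NON-VACUITY: exact shell DATA are freely prescribable (bounded smooth data launch classical solutions on a short window), and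
the hypothesis class is NON-EMPTY — every ZONAL `H` (uniaxial for `l = 2`) gives an axisymmetric swirl-free datum whose evolution
stays axisymmetric swirl-free, hence unthreaded about every axis point; the rung excludes the non-zonal data (instances on both
sides).  Proof route: `F ≡ 0` on `[t₀,t₁)` ⇒ the one-sided jet `∂ₜ²F(t₀⁺) ≡ 0`; the far-field form of `(u t₀, p t₀)` is that of
`OrderTwoHorizonLaw` with `U = c · horizonProfile l H`, so `0 = lim ρ² ∂ₜ²F = c³ 𝔏₂[U_H]` (`𝔏₂` is cubic in `U`). -/
def BoundedEndpointShellRungDatum : Prop :=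
  ∀ (u : ℝ → E3 → E3) (p : ℝ → E3 → ℝ) (x₀ : E3) (t₀ t₁ : ℝ) (l : ℕ) (H : E3 → ℝ) (h : ℝ → ℝ) (c : ℝ),
    t₀ < t₁ → Literature.Analysis.FluidPDE.IsClassicalNSSolutionOn (Set.Ico t₀ t₁) 1 0 u p →
    2 ≤ l → ContDiff ℝ (⊤ : ℕ∞) H → (∀ (a : ℝ) (y : E3), H (a • y) = a ^ l * H y) →
    (∀ y, Laplacian.laplacian H y = 0) → (∃ y, H y ≠ 0) →
    ContDiff ℝ (⊤ : ℕ∞) (fun y : E3 => h ‖y‖) → HasEndpointTail l h c →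
    Tendsto (fun x : E3 => p t₀ x / (1 + ‖x - x₀‖)) (Filter.cocompact E3) (𝓝 0) →
    u t₀ = shellSlice h H x₀ →
    (∀ t ∈ Set.Ioo t₀ t₁, ∀ x, threadingFlux u x₀ t x = 0) →
    ∀ x : E3, x ≠ 0 → horizonL2 (horizonProfile l H 0) 0 x = 0

/-- BOUNDED-ENDPOINT TAIL RUNG (v2, V9-P1's own repair; a COROLLARY of `OrderTwoHorizonLaw`): interior time of an open unthreaded
window, the slice only ASYMPTOTIC to a single-degree horizon profile — `u(t₀) = c·U_H + O(r^{−δ})` with six derivatives,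
`p(t₀) = P₀ + s₀ log r + O(r^{−δ})` with two — then `𝔏₂[U_H] ≡ 0`.  WITNESS CLASS (named, as asked): axisymmetric swirl-free
classical solutions launched from data equal to `c·U_H` with `H` ZONAL outside a ball — unthreaded about axis points on their window,
and (formally: the correction solves a forced problem with `O(r^{−1})` forcing `(U·∇)U + ∇P₀ − ΔU`, so `u(t) − c·U_H = O(t r^{−1})`) far
field preserved with `δ = 1`; the tail persistence is a CLAIM TO BE CHECKED, flagged, not assumed proved. -/
def BoundedEndpointTailRung : Prop :=
  ∀ (S : Set ℝ) (u : ℝ → E3 → E3) (p : ℝ → E3 → ℝ) (x₀ : E3) (t₀ : ℝ) (l : ℕ) (H : E3 → ℝ) (P₀ : E3 → ℝ) (c s₀ δ C : ℝ),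
    IsOpen S → t₀ ∈ S → Literature.Analysis.FluidPDE.IsClassicalNSSolutionOn S 1 0 u p → 0 < δ → c ≠ 0 →
    2 ≤ l → ContDiff ℝ (⊤ : ℕ∞) H → (∀ (a : ℝ) (y : E3), H (a • y) = a ^ l * H y) →
    (∀ y, Laplacian.laplacian H y = 0) → (∃ y, H y ≠ 0) →
    ContDiffOn ℝ (⊤ : ℕ∞) P₀ {x₀}ᶜ → (∀ a : ℝ, 0 < a → ∀ y : E3, P₀ (x₀ + a • y) = P₀ (x₀ + y)) →
    (∀ k ≤ 6, ∀ x : E3, 1 ≤ ‖x - x₀‖ →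
        ‖iteratedFDeriv ℝ k (fun z => u t₀ z - c • horizonProfile l H x₀ z) x‖ ≤ C * ‖x - x₀‖ ^ (-((k : ℝ) + δ))) →
    (∀ k ≤ 2, ∀ x : E3, 1 ≤ ‖x - x₀‖ →
        ‖iteratedFDeriv ℝ k (fun z => p t₀ z - P₀ z - s₀ * Real.log ‖z - x₀‖) x‖ ≤ C * ‖x - x₀‖ ^ (-((k : ℝ) + δ))) →
    (∀ t ∈ S, ∀ x, threadingFlux u x₀ t x = 0) →
    ∀ x : E3, x ≠ x₀ → horizonL2 (horizonProfile l H x₀) x₀ x = 0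

/-! ## v3 (ns-idea-15 g7 custodian, 2026-08-29): REGULARISED blow-down law and sieve (PRICE-LET HT-reg, ns-wall-crit-1
02:12:05Z / 02:25:03Z).  Lean's junk-derivative semantics: `IsBlowdownLimit` does NOT force `U ∈ C⁶(ℝ³∖{0})` / `P₀ ∈ C²` (the
`iteratedFDeriv` of a non-differentiable limit is the junk `0`), so the by-name closure of `OrderTwoHorizonLawBlowdown` may be
unreachable for junk reasons only.  The honest statements carry the limit regularity EXPLICITLY (paper-harmless: a `C⁶_loc` limit
of `C⁶`-convergent rescalings is automatic on paper); eng-4's (D′) closes `OrderTwoHorizonLawBlowdownReg` by name, and the sieve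
follows by the same one-line window instantiation as the landed `HorizonTower.horizonSieve_of_orderTwoHorizonLawBlowdown`
(p-landed `Theorems/ThreadingFluxHorizonTowerHorizonSieve.lean`).  The un-regularised Props stay (they imply the regularised ones).
Booking unchanged: LEVER rung of the horizon card, below W1; ⟨1222⟩ OPEN; NS regularity NOT proved. -/

/-- (D′-shape) ORDER-ONE/TWO HORIZON LAWS, BLOW-DOWN FORM, with the limit regularity `U ∈ C⁶(ℝ³∖{0})`, `P₀ ∈ C²(ℝ³∖{0})` as
explicit binders (inserted after the homogeneity hypotheses; otherwise verbatim `OrderTwoHorizonLawBlowdown`). -/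
def OrderTwoHorizonLawBlowdownReg : Prop :=
  ∀ (S : Set ℝ) (u : ℝ → E3 → E3) (p : ℝ → E3 → ℝ) (x₀ : E3) (t₀ : ℝ) (U : E3 → E3) (P₀ : E3 → ℝ) (s₀ : ℝ),
    IsOpen S → t₀ ∈ S → Literature.Analysis.FluidPDE.IsClassicalNSSolutionOn S 1 0 u p →
    (∀ t ∈ S, ∀ x, threadingFlux u x₀ t x = 0) →
    IsZeroHomogeneousAbout 0 U → (∀ c : ℝ, 0 < c → ∀ y : E3, P₀ (c • y) = P₀ y) →
    ContDiffOn ℝ 6 U ({0}ᶜ : Set E3) → ContDiffOn ℝ 2 P₀ ({0}ᶜ : Set E3) →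
    IsBlowdownLimit (u t₀) (p t₀) x₀ U (fun y : E3 => P₀ y + s₀ * Real.log ‖y‖) →
    ∀ y : E3, y ≠ 0 → horizonL1 U 0 y = 0 ∧ horizonL2 U 0 y = 0

/-- (D′-shape) HORIZON SIEVE with the same two regularity binders on the blow-down limit (otherwise verbatim `HorizonSieve`). -/
def HorizonSieveReg : Prop :=
  ∀ (v : ℝ → E3 → E3) (p : ℝ → E3 → ℝ) (x₀ : E3),
    Literature.Analysis.FluidPDE.IsBoundedAncientMildSolution 1 v →
    Literature.Analysis.FluidPDE.IsClassicalNSSolutionOn (Set.Iio 0) 1 0 v p →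
    (∀ t < 0, ∀ x, inner ℝ (x - x₀) (curl (v t) x) = 0) →
    ∀ t₀ < 0, ∀ (U : E3 → E3) (P₀ : E3 → ℝ) (s₀ : ℝ),
      IsZeroHomogeneousAbout 0 U → (∀ c : ℝ, 0 < c → ∀ y : E3, P₀ (c • y) = P₀ y) →
      ContDiffOn ℝ 6 U ({0}ᶜ : Set E3) → ContDiffOn ℝ 2 P₀ ({0}ᶜ : Set E3) →
      IsBlowdownLimit (v t₀) (p t₀) x₀ U (fun y : E3 => P₀ y + s₀ * Real.log ‖y‖) →
      ∀ y : E3, y ≠ 0 → horizonL1 U 0 y = 0 ∧ horizonL2 U 0 y = 0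

/-- The un-regularised law implies the regularised one (drop the two extra binders). -/
theorem orderTwoHorizonLawBlowdownReg_of (h : OrderTwoHorizonLawBlowdown) : OrderTwoHorizonLawBlowdownReg :=
  fun S u p x₀ t₀ U P₀ s₀ hS ht₀ hcl hun hU hP₀ _ _ hbl => h S u p x₀ t₀ U P₀ s₀ hS ht₀ hcl hun hU hP₀ hbl

/-- The un-regularised sieve implies the regularised one. -/
theorem horizonSieveReg_of (h : HorizonSieve) : HorizonSieveReg :=
  fun v p x₀ hb hcl hun t₀ ht₀ U P₀ s₀ hU hP₀ _ _ hbl => h v p x₀ hb hcl hun t₀ ht₀ U P₀ s₀ hU hP₀ hbl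

/-- KERNEL GLUE (regularised): `OrderTwoHorizonLawBlowdownReg → HorizonSieveReg` — the open window `S = (−∞,0)`, on which the
sieve's solution is classical and unthreaded about `x₀` (same instantiation as the landed un-regularised glue). -/
theorem horizonSieveReg_of_orderTwoHorizonLawBlowdownReg (hlaw : OrderTwoHorizonLawBlowdownReg) : HorizonSieveReg := by
  intro v p x₀ _hbdd hcl hunthr t₀ ht₀ U P₀ s₀ hU hP₀ hUr hPr hblow y hy
  refine hlaw (Set.Iio 0) v p x₀ t₀ U P₀ s₀ isOpen_Iio ht₀ hcl ?_ hU hP₀ hUr hPr hblow y hy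
  intro t ht x
  unfold threadingFlux
  rw [real_inner_comm]
  exact hunthr t ht x

/-! ## By-name kernel closure (v-next): the single-degree obstruction is a THEOREM in the tree -/
section ByName
open Summit.NavierStokesRegularity.NavierStokesRegularity.Theorems.PoloidalLiouville

example : HorizonZonalitySingleDegree ↔ HorizonTower.HorizonZonalitySingleDegree := Iff.rfl

/-- HORIZON ZONALITY at every single degree `l ≥ 2` holds (kernel, by name: eng-5 p680436). -/
theorem horizonZonalitySingleDegree_holds : HorizonZonalitySingleDegree := HorizonTower.horizonZonalitySingleDegree

end ByName

/-! ## v4 (ns-idea-15 g8 custodian, 2026-08-29): CLOSED-BY-NAME LEDGER of the line + two-shell towers + the order-one blow-down law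

Custodian record (tree read 2026-08-29T04:0xZ; every closure below is a kernel theorem of `Theorems/`, std axioms, closing a Prop
of the Defs twin `Theorems.PoloidalLiouville.HorizonTower` whose body is VERBATIM the sketch's):
`HeadVirialIdentity`, `OrderOneFluxIdentity` (`ThreadingFluxHorizonTowerFirstLemmasByName`), `SecondJetHeadForm`,
`HorizonProfileStructure`, `OrderOneSphereEuler`, the table `HorizonL2Quadrupole` / `HorizonL2Tetrahedral` / `HorizonL2Octahedral` /
`HorizonL2Zonal`, `HorizonZonalitySingleDegree` at EVERY degree `l ≥ 2` (v-next section above; the Defs docstring «open: l ≥ 7» is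
stale), `TwoShellBracketZonality`, `TwoShellHorizonTowerZonality` (this section), the ORDER-ONE blow-down law for ANY `C²` blow-down
limit (this section, `OrderOneHorizonLawBlowdown`), and the kernel glue `OrderTwoHorizonLawBlowdown(Reg) → HorizonSieve(Reg)`.
LANDED 2026-08-29T04:04Z and closed by name in section `LeverAndSieve` below: ★ THE LEVER `OrderTwoHorizonLaw` (ns-wall-eng-4 g4,
p694270, `Theorems/ThreadingFluxHorizonTowerOrderTwoLaw.lean`) ⇒ `BoundedEndpointTailRung` UNCONDITIONAL, and the regularised
order-two blow-down law `OrderTwoHorizonLawBlowdownReg` ⇒ `HorizonSieveReg` (p694045, `Theorems/ThreadingFluxHorizonOrderTwoLawBlowdown.lean`).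
DIRECTOR'S RULINGS OF RECORD on the OPEN LIST (director-ns g17, wall board 2026-08-29T04:09:29Z): (1) the Reg pair IS the sieve of
record — the un-regularised `OrderTwoHorizonLawBlowdown` / `HorizonSieve` are marked SUPERSEDED below (kernel glue kept as record;
nobody keyed on the `fderiv`-junk bookkeeping); (2) `HorizonTowerZonality` (≥ 3 shells / general 0-homogeneous profiles) is THE typed
OPEN target of the line (CONJECTURE, no rung credit; eng-3 lineage); (3) the SCOPE GAP is TYPED here as the named Prop
`ScaleFreeFarField` (section `ScopeGap`) — a NAMED GAP for the W1 board, typed not attacked; (4) horizon ⇒ bulk is the wall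
(SAME-WALL STRIKE applies).  STRUCTURAL REMARK (ns-wall-eng-3 g3, 04:00:20Z, TwoShellTowers-RESULTS.md §4c): ORDER ONE ALONE DOES NOT
DECIDE GENERAL TOWERS — every smooth 0-homogeneous `Φ` gives an admissible profile `U_Φ = f ξ + r∇Φ`, and `𝔏₁[U_Φ] ∝ {Δ_SΦ, Φ}`
vanishes iff `Φ|S²` is a STATIONARY sphere-Euler stream function; NON-ZONAL smooth ones exist (tetrahedral mean-field solutions,
Gui–Hu arXiv:1709.02474; rigidity needs hypotheses, Constantin–Germain arXiv:2109.08797 Thm 4), so `HorizonTowerZonality` with the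
`𝔏₁` hypothesis alone is FALSE for general profiles and any proof must use `𝔏₂`; decisive open computation: `𝔏₂[U_ψ]` for a
non-zonal mean-field `ψ`.
STILL OPEN between the lever and `PoloidalLiouville` (custodian OPEN LIST, wall board 2026-08-29T03:56:49Z, as ruled 04:09:29Z):
(1) [SUPERSEDED — not a target] the un-regularised pair `OrderTwoHorizonLawBlowdown` / `HorizonSieve` (differs from the Reg pair only
by the binders `ContDiffOn ℝ 6 U {0}ᶜ`, `ContDiffOn ℝ 2 P₀ {0}ᶜ` — `fderiv`-junk bookkeeping, no mathematics); (2) `HorizonTowerZonality` for finite towers with ≥ 3 shells and for infinite towers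
(CONJECTURE, no rung credit, V9-P4); (3) the scope gap V9-P2 (a bounded ancient unthreaded solution need not have a scale-free far
field; the chain is silent there); (4) HORIZON ⇒ BULK: «zonal at the horizon ⇒ axisymmetric without swirl on some open set of some
slice» — false for general analytic divergence-free sphere-tangent fields, hence a statement about bounded ANCIENT dynamics, i.e. the
wall `stub_scalarLiouville` in horizon language (the «silent-shells» trigger `LocalAxisTrigger0`, `SilentShellsSketch.lean` v1.3, is
KERNEL-REDUCED to slice analyticity + gauge-covariant axisymmetry propagation: exact axisymmetry on one open set of one slice already
suffices, and «axisymmetric + unthreaded about an axis point ⇒ no swirl ⇒ KNSS» is a kernel chain there); (5) the wall itself.  `PoloidalLiouville` (1222) OPEN; NS regularity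
NOT proved. -/

section TwoShell
open Summit.NavierStokesRegularity.NavierStokesRegularity.Theorems.PoloidalLiouville

/-- TWO-SHELL ZONALITY, BRACKET FORM (Defs twin l.335, body VERBATIM; THEOREM by name: ns-wall-eng-3 p691694
`HorizonTower.twoShellBracketZonality`, from `Zonal.mixedDegreeBracketRigidity`): two nonzero solid harmonics `A ∈ 𝓗_l`, `B ∈ 𝓗_m` of
DIFFERENT degrees whose bracket `⟪y, ∇A × ∇B⟫` vanishes identically are zonal about ONE COMMON axis. -/
def TwoShellBracketZonality : Prop :=
  ∀ (l m : ℕ) (A B : E3 → ℝ), 1 ≤ l → 1 ≤ m → l ≠ m →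
    ContDiff ℝ (⊤ : ℕ∞) A → (∀ (c : ℝ) (y : E3), A (c • y) = c ^ l * A y) → (∀ y, Laplacian.laplacian A y = 0) →
    ContDiff ℝ (⊤ : ℕ∞) B → (∀ (c : ℝ) (y : E3), B (c • y) = c ^ m * B y) → (∀ y, Laplacian.laplacian B y = 0) →
    (∃ y, A y ≠ 0) → (∃ y, B y ≠ 0) →
    (∀ x : E3, inner ℝ x (cross (gradient A x) (gradient B x)) = 0) →
    ∃ (a : E3) (gA gB : ℝ → ℝ), a ≠ 0 ∧
      (∀ y : E3, y ≠ 0 → A y = ‖y‖ ^ l * gA (inner ℝ a y / ‖y‖)) ∧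
      (∀ y : E3, y ≠ 0 → B y = ‖y‖ ^ m * gB (inner ℝ a y / ‖y‖))

/-- TWO-SHELL HORIZON TOWER ZONALITY AT ORDER ONE (Defs twin l.352, body VERBATIM) = the TWO-SHELL, centre-`0` case of the
conjecture `HorizonTowerZonality`, decided by the ORDER-ONE law alone: a scale-free two-shell tower `U_A + U_B` (`l ≠ m`, both shells
nonzero) annihilated by `𝔏₁` off the centre is coaxially zonal (axisymmetric without swirl).  THEOREM by name: ns-wall-eng-3 p691920
`HorizonTower.twoShellHorizonTowerZonality`.  Finite towers with ≥ 3 shells and infinite towers: OPEN. -/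
def TwoShellHorizonTowerZonality : Prop :=
  ∀ (l m : ℕ) (A B : E3 → ℝ), 1 ≤ l → 1 ≤ m → l ≠ m →
    ContDiff ℝ (⊤ : ℕ∞) A → (∀ (c : ℝ) (y : E3), A (c • y) = c ^ l * A y) → (∀ y, Laplacian.laplacian A y = 0) →
    ContDiff ℝ (⊤ : ℕ∞) B → (∀ (c : ℝ) (y : E3), B (c • y) = c ^ m * B y) → (∀ y, Laplacian.laplacian B y = 0) →
    (∃ y, A y ≠ 0) → (∃ y, B y ≠ 0) →
    (∀ x : E3, x ≠ 0 → horizonL1 (fun z => horizonProfile l A 0 z + horizonProfile m B 0 z) 0 x = 0) →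
    ∃ (a : E3) (gA gB : ℝ → ℝ), a ≠ 0 ∧
      (∀ y : E3, y ≠ 0 → A y = ‖y‖ ^ l * gA (inner ℝ a y / ‖y‖)) ∧
      (∀ y : E3, y ≠ 0 → B y = ‖y‖ ^ m * gB (inner ℝ a y / ‖y‖))

-- `Iff.rfl` guards: the sketch copies are SYNTACTICALLY the Defs-twin Props (so the by-name closures below close THESE decls).
example : TwoShellBracketZonality ↔ HorizonTower.TwoShellBracketZonality := Iff.rfl
example : TwoShellHorizonTowerZonality ↔ HorizonTower.TwoShellHorizonTowerZonality := Iff.rfl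

/-- By name (eng-3 p691694). -/
theorem twoShellBracketZonality_holds : TwoShellBracketZonality := HorizonTower.twoShellBracketZonality

/-- By name (eng-3 p691920): the two-shell case of `HorizonTowerZonality` holds, at order one. -/
theorem twoShellHorizonTowerZonality_holds : TwoShellHorizonTowerZonality := HorizonTower.twoShellHorizonTowerZonality

end TwoShell

section OrderOneBlowdown
open Summit.NavierStokesRegularity.NavierStokesRegularity.Theorems.PoloidalLiouville

/-- THE ORDER-ONE HORIZON LAW, BLOW-DOWN FORM (the `𝔏₁` half of `OrderTwoHorizonLawBlowdown`, typed on its own and STRONGER there: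
ANY `C²` blow-down limit `U` of an unthreaded slice of a classical NS solution on an open window — no homogeneity of `U`, no decay
rate, any pressure datum `P₀` — is annihilated by `𝔏₁`).  THEOREM by name: ns-wall-eng-4 `HorizonTower.orderOneHorizonLawBlowdown`
(`Theorems/ThreadingFluxHorizonOrderOneLawBlowdown.lean`; mechanism: the order-one threading coefficient vanishes by
`LoopLaw.firstOrderLawOfUnthreadedEvolution`, and `⟪z, curl(curl Uₖ × Uₖ)(z)⟫ = λₖ c₁(x₀ + λₖ z)` passes to the limit).  This is exactly
the first-law hypothesis of `HorizonTowerZonality` for blow-down towers. -/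
def OrderOneHorizonLawBlowdown : Prop :=
  ∀ (S : Set ℝ) (u : ℝ → E3 → E3) (p : ℝ → E3 → ℝ) (x₀ : E3) (t₀ : ℝ) (U : E3 → E3) (P₀ : E3 → ℝ),
    IsOpen S → t₀ ∈ S → Literature.Analysis.FluidPDE.IsClassicalNSSolutionOn S 1 0 u p →
    (∀ t ∈ S, ∀ x, threadingFlux u x₀ t x = 0) → ContDiffOn ℝ 2 U ({0}ᶜ : Set E3) →
    IsBlowdownLimit (u t₀) (p t₀) x₀ U P₀ →
    ∀ y : E3, y ≠ 0 → horizonL1 U 0 y = 0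

/-- By name (eng-4): the order-one blow-down law holds.  (The sketch's `threadingFlux` / `horizonL1` / `IsBlowdownLimit` are
definitionally the Defs twin's, so the tree theorem applies verbatim.) -/
theorem orderOneHorizonLawBlowdown_holds : OrderOneHorizonLawBlowdown :=
  fun S u p x₀ t₀ U P₀ hS ht₀ hNS hF hU hbd =>
    HorizonTower.orderOneHorizonLawBlowdown S u p x₀ t₀ U P₀ hS ht₀ hNS hF hU hbd

/-- Hence the `𝔏₁` conjunct of the un-regularised `OrderTwoHorizonLawBlowdown` holds outright (for its homogeneous, `C⁶`-off-`0`
blow-down limits a fortiori) — recorded so that only the `𝔏₂` conjunct of item (1) of the OPEN LIST remains. -/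
theorem orderTwoHorizonLawBlowdown_L1_conjunct
    (S : Set ℝ) (u : ℝ → E3 → E3) (p : ℝ → E3 → ℝ) (x₀ : E3) (t₀ : ℝ) (U : E3 → E3) (P₀ : E3 → ℝ) (s₀ : ℝ)
    (hS : IsOpen S) (ht₀ : t₀ ∈ S) (hNS : Literature.Analysis.FluidPDE.IsClassicalNSSolutionOn S 1 0 u p)
    (hF : ∀ t ∈ S, ∀ x, threadingFlux u x₀ t x = 0) (hU : ContDiffOn ℝ 2 U ({0}ᶜ : Set E3))
    (hbd : IsBlowdownLimit (u t₀) (p t₀) x₀ U (fun y : E3 => P₀ y + s₀ * Real.log ‖y‖)) :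
    ∀ y : E3, y ≠ 0 → horizonL1 U 0 y = 0 :=
  orderOneHorizonLawBlowdown_holds S u p x₀ t₀ U _ hS ht₀ hNS hF hU hbd

end OrderOneBlowdown

/-! ## v4: THE LEVER and THE SIEVE OF RECORD are theorems (by name) -/
section LeverAndSieve
open Summit.NavierStokesRegularity.NavierStokesRegularity.Theorems.PoloidalLiouville

example : OrderTwoHorizonLaw ↔ HorizonTower.OrderTwoHorizonLaw := Iff.rfl
example : BoundedEndpointTailRung ↔ HorizonTower.BoundedEndpointTailRung := Iff.rfl

/-- ★ THE LEVER holds (kernel, by name: ns-wall-eng-4 g4, p694270): a scale-free `C⁶` far field `U + O(r^{−δ})` of an unthreaded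
slice of a classical NS solution on an open window, with pressure `P₀ + s₀ log r + O(r^{−δ})`, has `𝔏₂[U] ≡ 0` off the origin. -/
theorem orderTwoHorizonLaw_holds : OrderTwoHorizonLaw :=
  Summit.NavierStokesRegularity.NavierStokesRegularity.Theorems.PoloidalLiouville.HorizonTower.orderTwoHorizonLaw_holds

/-- The bounded-endpoint TAIL RUNG holds UNCONDITIONALLY (kernel, by name, p694270). -/
theorem boundedEndpointTailRung_holds : BoundedEndpointTailRung :=
  Summit.NavierStokesRegularity.NavierStokesRegularity.Theorems.PoloidalLiouville.HorizonTower.boundedEndpointTailRung_holds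

/-- The regularised order-two blow-down law holds (kernel, by name: p694045). -/
theorem orderTwoHorizonLawBlowdownReg_holds : OrderTwoHorizonLawBlowdownReg :=
  fun S u p x₀ t₀ U P₀ s₀ hS ht₀ hNS hF hUhom hPhom hU hP hbd =>
    HorizonTower.orderTwoHorizonLawBlowdownReg S u p x₀ t₀ U P₀ s₀ hS ht₀ hNS hF hUhom hPhom hU hP hbd

/-- ★ THE SIEVE OF RECORD holds (kernel, by name: p694045): under the hypotheses of `PoloidalLiouville` with any classical pressure,
every degree-0 homogeneous blow-down limit `(U, P₀ + s₀ log r)`, `C⁶ × C²` off the origin, of every slice is annihilated by BOTH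
horizon laws. -/
theorem horizonSieveReg_holds : HorizonSieveReg :=
  fun v p x₀ hb hcl hun t₀ ht₀ U P₀ s₀ hUhom hPhom hU hP hbd =>
    HorizonTower.horizonSieveReg v p x₀ hb hcl hun t₀ ht₀ U P₀ s₀ hUhom hPhom hU hP hbd

/-- Consistency: the sieve of record also follows from the law of record by the sketch's own kernel glue. -/
example : HorizonSieveReg := horizonSieveReg_of_orderTwoHorizonLawBlowdownReg orderTwoHorizonLawBlowdownReg_holds

end LeverAndSieve

/-! ## v4: the SCOPE GAP, typed (director ruling (3)) -/
section ScopeGap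

/-- (**FALSE AS TYPED — v5 note: Galilean/pressure gauge witness, `not_scaleFreeFarField` (crit-1 / eng-5, p696433); kept as the
settled negative edge; REPLACED by C′ `ScaleFreeFarFieldSublinear` below.**)  **SCOPE GAP `ScaleFreeFarField` (V9-P2), typed as a NAMED GAP at the director's request (ruling (3), 2026-08-29T04:09:29Z) —
typed, NOT attacked; BC7 by ns-wall-crit-1.**  The exact far-field hypothesis the HorizonTower chain consumes, stated for W1's
class: every slice of a bounded ancient mild solution that is classical on `(−∞,0)` with some pressure and unthreaded about `x₀`
admits, at every time, a degree-0 homogeneous blow-down limit `(U, P₀ + s₀ log r)` in the `C⁶ × C²` sense of `IsBlowdownLimit`,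
regular off the origin.  STATUS: a CONSEQUENCE of `PoloidalLiouville` (a constant slice has the constant as its blow-down limit);
for general bounded ancient solutions it is plausibly FALSE (bounded derivatives are not `O(r^{−j})`, no limit point need exist) —
which is exactly why it is a GAP: the sieve `HorizonSieveReg` binds only the scale-free cell, and this Prop says «W1's class IS the
scale-free cell».  Nothing here claims it. -/
def ScaleFreeFarField : Prop :=
  ∀ (v : ℝ → E3 → E3) (p : ℝ → E3 → ℝ) (x₀ : E3),
    Literature.Analysis.FluidPDE.IsBoundedAncientMildSolution 1 v →
    Literature.Analysis.FluidPDE.IsClassicalNSSolutionOn (Set.Iio 0) 1 0 v p →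
    (∀ t < 0, ∀ x, inner ℝ (x - x₀) (curl (v t) x) = 0) →
    ∀ t₀ < 0, ∃ (U : E3 → E3) (P₀ : E3 → ℝ) (s₀ : ℝ),
      IsZeroHomogeneousAbout 0 U ∧ (∀ c : ℝ, 0 < c → ∀ y : E3, P₀ (c • y) = P₀ y) ∧
      ContDiffOn ℝ 6 U ({0}ᶜ : Set E3) ∧ ContDiffOn ℝ 2 P₀ ({0}ᶜ : Set E3) ∧
      IsBlowdownLimit (v t₀) (p t₀) x₀ U (fun y : E3 => P₀ y + s₀ * Real.log ‖y‖)

/-- What the chain then gives in kernel (GAP + SIEVE OF RECORD): in W1's class with a classical pressure, EVERY slice has a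
scale-free horizon `U` that is a JOINT ZERO of both horizon laws.  (The remaining links — `𝔏₁ = 𝔏₂ = 0 ⇒ U zonal`, i.e.
`HorizonTowerZonality`-type rigidity for general profiles, and «zonal horizon ⇒ axisymmetric slice on an open set», i.e. horizon ⇒
bulk = the wall — are OPEN LIST items (2) and (4).) -/
theorem horizonAnnihilated_of_scaleFreeFarField (hgap : ScaleFreeFarField) (hsieve : HorizonSieveReg)
    (v : ℝ → E3 → E3) (p : ℝ → E3 → ℝ) (x₀ : E3)
    (hb : Literature.Analysis.FluidPDE.IsBoundedAncientMildSolution 1 v)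
    (hcl : Literature.Analysis.FluidPDE.IsClassicalNSSolutionOn (Set.Iio 0) 1 0 v p)
    (hun : ∀ t < 0, ∀ x, inner ℝ (x - x₀) (curl (v t) x) = 0) (t₀ : ℝ) (ht₀ : t₀ < 0) :
    ∃ (U : E3 → E3) (P₀ : E3 → ℝ) (s₀ : ℝ), IsZeroHomogeneousAbout 0 U ∧
      IsBlowdownLimit (v t₀) (p t₀) x₀ U (fun y : E3 => P₀ y + s₀ * Real.log ‖y‖) ∧
      ∀ y : E3, y ≠ 0 → horizonL1 U 0 y = 0 ∧ horizonL2 U 0 y = 0 := by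
  obtain ⟨U, P₀, s₀, hUhom, hPhom, hU, hP, hbd⟩ := hgap v p x₀ hb hcl hun t₀ ht₀
  exact ⟨U, P₀, s₀, hUhom, hbd, hsieve v p x₀ hb hcl hun t₀ ht₀ U P₀ s₀ hUhom hPhom hU hP hbd⟩

/-- … and unconditionally in the sieve (it is a theorem): the GAP alone puts every slice's horizon in the joint zero set. -/
theorem horizonAnnihilated_of_scaleFreeFarField' (hgap : ScaleFreeFarField)
    (v : ℝ → E3 → E3) (p : ℝ → E3 → ℝ) (x₀ : E3)
    (hb : Literature.Analysis.FluidPDE.IsBoundedAncientMildSolution 1 v)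
    (hcl : Literature.Analysis.FluidPDE.IsClassicalNSSolutionOn (Set.Iio 0) 1 0 v p)
    (hun : ∀ t < 0, ∀ x, inner ℝ (x - x₀) (curl (v t) x) = 0) (t₀ : ℝ) (ht₀ : t₀ < 0) :
    ∃ (U : E3 → E3) (P₀ : E3 → ℝ) (s₀ : ℝ), IsZeroHomogeneousAbout 0 U ∧
      IsBlowdownLimit (v t₀) (p t₀) x₀ U (fun y : E3 => P₀ y + s₀ * Real.log ‖y‖) ∧
      ∀ y : E3, y ≠ 0 → horizonL1 U 0 y = 0 ∧ horizonL2 U 0 y = 0 :=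
  horizonAnnihilated_of_scaleFreeFarField hgap horizonSieveReg_holds v p x₀ hb hcl hun t₀ ht₀

/-! ### v5 (custodian ns-idea-15 g9, 2026-08-29): the GAP re-typed — `ScaleFreeFarField` is FALSE AS TYPED
(critic ns-wall-crit-1 04:27:52Z/04:31:36Z; kernel `not_scaleFreeFarField`, landing of record eng-5 g6
`ThreadingFluxHorizonTowerScaleFreeFarFieldGauge.lean`, Theorems-side p696433): the accelerated rest frame `v(t,·) ≡ β(t)w`,
`p(t,y) = −β′(t)⟪w,y⟫` is in the class, classical, unthreaded about every centre, and its LINEAR pressure has no blow-down limit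
modulo constants.  CLASS: MISSTATED (Galilean / pressure gauge).  REPAIR C′ = option (c) of the critic's list: add the gauge-fixing
hypothesis «every slice pressure is SUBLINEAR at infinity» (`|p(t,y)| ≤ ε‖y‖` far out).  Why this is the right gauge: for a bounded
ancient solution with bounded derivatives the CANONICAL pressure `p = R_iR_j(v_iv_j)` is smooth, `BMO`, with `∇p = −∂ₜv − (v·∇)v + Δv`
bounded, hence `|p(t,y)| ≲ log(2 + ‖y‖)` — sublinear; the parasitic frames have `|p| ≍ ‖y‖` and are excluded; and under C′ the v4
docstring sentence becomes TRUE: a constant slice `b(t)` with classical sublinear pressure forces `b′(t) = 0`, `p(t,·) ≡ c(t)`, and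
`(U, P₀, s₀) = (b(t₀), 0, 0)` IS a blow-down limit — so C′ is again a CONSEQUENCE of `PoloidalLiouville`, as a gap should be.  The v4
decl stays below as the settled negative edge; the chain's kernel glue is re-threaded with the extra binder (`…_sublinear`). -/

/-- Sublinear growth of a scalar field at infinity (the pressure gauge of C′): `∀ ε > 0, ∃ R, ∀ y, R ≤ ‖y‖ → |q y| ≤ ε‖y‖`. -/
def IsSublinearAtInfinity (q : E3 → ℝ) : Prop :=
  ∀ ε : ℝ, 0 < ε → ∃ R : ℝ, ∀ y : E3, R ≤ ‖y‖ → |q y| ≤ ε * ‖y‖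

/-- **C′ = SCOPE GAP `ScaleFreeFarFieldSublinear` (v5; replaces `ScaleFreeFarField`, which is false as typed).**  In W1's class
with a classical pressure that is SUBLINEAR AT INFINITY on every slice (canonical gauge), every slice admits at every time a degree-0
homogeneous blow-down limit `(U, P₀ + s₀ log r)`, `C⁶ × C²` off the origin.  STATUS: typed, NOT attacked; a consequence of
`PoloidalLiouville` (constant slices, see above); plausibly FALSE for general bounded ancient solutions (no `O(r^{−j})` derivative decay)
— it says «W1's class, canonically gauged, IS the scale-free cell».  The critic's witness (linear pressure) misses it. -/
def ScaleFreeFarFieldSublinear : Prop :=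
  ∀ (v : ℝ → E3 → E3) (p : ℝ → E3 → ℝ) (x₀ : E3),
    Literature.Analysis.FluidPDE.IsBoundedAncientMildSolution 1 v →
    Literature.Analysis.FluidPDE.IsClassicalNSSolutionOn (Set.Iio 0) 1 0 v p →
    (∀ t < 0, IsSublinearAtInfinity (p t)) →
    (∀ t < 0, ∀ x, inner ℝ (x - x₀) (curl (v t) x) = 0) →
    ∀ t₀ < 0, ∃ (U : E3 → E3) (P₀ : E3 → ℝ) (s₀ : ℝ),
      IsZeroHomogeneousAbout 0 U ∧ (∀ c : ℝ, 0 < c → ∀ y : E3, P₀ (c • y) = P₀ y) ∧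
      ContDiffOn ℝ 6 U ({0}ᶜ : Set E3) ∧ ContDiffOn ℝ 2 P₀ ({0}ᶜ : Set E3) ∧
      IsBlowdownLimit (v t₀) (p t₀) x₀ U (fun y : E3 => P₀ y + s₀ * Real.log ‖y‖)

/-- The false-as-typed v4 GAP trivially implies C′ (C′ only adds a hypothesis) — recorded so nothing downstream weakens. -/
theorem scaleFreeFarFieldSublinear_of_scaleFreeFarField (h : ScaleFreeFarField) : ScaleFreeFarFieldSublinear :=
  fun v p x₀ hb hcl _ hun t₀ ht₀ => h v p x₀ hb hcl hun t₀ ht₀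

/-- (v5 glue of record) C′ + SIEVE OF RECORD: in W1's class with a classical, slice-wise sublinear pressure, EVERY slice has a
scale-free horizon `U` that is a JOINT ZERO of both horizon laws. -/
theorem horizonAnnihilated_of_scaleFreeFarFieldSublinear (hgap : ScaleFreeFarFieldSublinear) (hsieve : HorizonSieveReg)
    (v : ℝ → E3 → E3) (p : ℝ → E3 → ℝ) (x₀ : E3)
    (hb : Literature.Analysis.FluidPDE.IsBoundedAncientMildSolution 1 v)
    (hcl : Literature.Analysis.FluidPDE.IsClassicalNSSolutionOn (Set.Iio 0) 1 0 v p)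
    (hsub : ∀ t < 0, IsSublinearAtInfinity (p t))
    (hun : ∀ t < 0, ∀ x, inner ℝ (x - x₀) (curl (v t) x) = 0) (t₀ : ℝ) (ht₀ : t₀ < 0) :
    ∃ (U : E3 → E3) (P₀ : E3 → ℝ) (s₀ : ℝ), IsZeroHomogeneousAbout 0 U ∧
      IsBlowdownLimit (v t₀) (p t₀) x₀ U (fun y : E3 => P₀ y + s₀ * Real.log ‖y‖) ∧
      ∀ y : E3, y ≠ 0 → horizonL1 U 0 y = 0 ∧ horizonL2 U 0 y = 0 := by
  obtain ⟨U, P₀, s₀, hUhom, hPhom, hU, hP, hbd⟩ := hgap v p x₀ hb hcl hsub hun t₀ ht₀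
  exact ⟨U, P₀, s₀, hUhom, hbd, hsieve v p x₀ hb hcl hun t₀ ht₀ U P₀ s₀ hUhom hPhom hU hP hbd⟩

/-- … and with the sieve discharged by name (`horizonSieveReg_holds`, p694045): C′ ALONE puts every slice's horizon in the joint
zero set of the two horizon laws. -/
theorem horizonAnnihilated_of_scaleFreeFarFieldSublinear' (hgap : ScaleFreeFarFieldSublinear)
    (v : ℝ → E3 → E3) (p : ℝ → E3 → ℝ) (x₀ : E3)
    (hb : Literature.Analysis.FluidPDE.IsBoundedAncientMildSolution 1 v)
    (hcl : Literature.Analysis.FluidPDE.IsClassicalNSSolutionOn (Set.Iio 0) 1 0 v p)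
    (hsub : ∀ t < 0, IsSublinearAtInfinity (p t))
    (hun : ∀ t < 0, ∀ x, inner ℝ (x - x₀) (curl (v t) x) = 0) (t₀ : ℝ) (ht₀ : t₀ < 0) :
    ∃ (U : E3 → E3) (P₀ : E3 → ℝ) (s₀ : ℝ), IsZeroHomogeneousAbout 0 U ∧
      IsBlowdownLimit (v t₀) (p t₀) x₀ U (fun y : E3 => P₀ y + s₀ * Real.log ‖y‖) ∧
      ∀ y : E3, y ≠ 0 → horizonL1 U 0 y = 0 ∧ horizonL2 U 0 y = 0 :=
  horizonAnnihilated_of_scaleFreeFarFieldSublinear hgap horizonSieveReg_holds v p x₀ hb hcl hsub hun t₀ ht₀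

/-- Sanity (the critic's witness class is excluded by the gauge): a non-zero LINEAR function is not sublinear at infinity. -/
theorem not_isSublinearAtInfinity_linear {w : E3} (hw : w ≠ 0) :
    ¬ IsSublinearAtInfinity (fun y : E3 => inner ℝ w y) := by
  intro h
  obtain ⟨R, hR⟩ := h (‖w‖ / 2) (by positivity)
  -- test on y = s • w with s large
  have hwpos : 0 < ‖w‖ := norm_pos_iff.2 hw
  set s : ℝ := max R 1 / ‖w‖ + 1 with hs_def
  have hs : 0 < s := by positivity
  have hy : R ≤ ‖s • w‖ := by
    rw [norm_smul, Real.norm_eq_abs, abs_of_pos hs, hs_def, add_mul, div_mul_cancel₀ _ hwpos.ne']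
    linarith [le_max_left R 1, le_max_right R 1, hwpos]
  have h1 := hR (s • w) hy
  dsimp only at h1
  rw [inner_smul_right, real_inner_self_eq_norm_sq, norm_smul, Real.norm_eq_abs, abs_of_pos hs] at h1
  rw [abs_of_pos (by positivity : 0 < s * ‖w‖ ^ 2)] at h1
  nlinarith [mul_pos hs (pow_pos hwpos 2)]

end ScopeGap

end Summit.NavierStokesRegularity.NavierStokesRegularity.Cruxes.PoloidalLiouville.HorizonTower
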